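import Summits.Ventures.HodgeRepro2.T5BergmanSchurGeneral

/-!
# The `K`-finite matrix coefficients `⟨π_k(g) zᵐ, zⁿ⟩_k` in closed form, and their decay

For `g = (a, b; b̄, ā) ∈ SU(1,1)`, the translate of a monomial is
`(π_k(g) zᵐ)(w) = (ā w - b)ᵐ (a - b̄ w)^{-(k+m)} = a^{-(k+m)} (ā w - b)ᵐ K^{(k+m)}_{b/ā}(w)`
(`act_monomial_eq`), the product of a polynomial and the coherent state of weight `k+m`. Its Taylor
expansion is the Cauchy product of the binomial expansion of `(ā w - b)ᵐ` with the binomial series of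
the coherent state (`act_monomial_hasSum`), and the reproducing formula for the Taylor coefficients
(`T5BergmanFourier.pairing_monomial_right`) gives the **closed form of the `K`-finite matrix coefficients**

  `⟨π_k(g) zᵐ, zⁿ⟩_k = a^{-(k+m)} ⟨zⁿ,zⁿ⟩_k Σ_{i ≤ min(m,n)} C(m,i) āⁱ (-b)^{m-i} C(n-i+k+m-1, n-i) (b̄/a)^{n-i}`

(`matrixCoeff_monomial_monomial`) — Rühl's radial functions `d^J_{q₁q₂}` as finite sums (the
bicovariance in `u, v` is `T5BergmanCoeffCartan`). Since `|b| < |a|` and `|b̄/a| < 1`, every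
`K`-finite coefficient DECAYS like `|a(g)|^{-k}` (`norm_matrixCoeff_monomial_monomial_le`).

Blind lane: Mathlib + the HodgeRepro2 prefix only; no sorry; axioms ⊆ {propext, Classical.choice,
Quot.sound}.
-/

namespace Summit.Ventures.HodgeRepro2.T5BergmanKTypeMatrix

open MeasureTheory Metric Filter Topology Finset
open T5PoincareDensity T5SU11Unimodular T5SU11Fibration
open T5BergmanCoefficient T5BergmanPairing T5BergmanUnitary T5BergmanFourier T5BergmanKernel
  T5BergmanParseval T5BergmanActStable T5BergmanMatrixCoeff T5BergmanSchur T5BergmanSchurGeneral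
open scoped Real

/-- The binomial coefficients of `(ā w - b)ᵐ`: `p_i = C(m,i) āⁱ (-b)^{m-i}` for `i ≤ m`, `0` beyond. -/
noncomputable def polyCoeff (g : SU11) (m i : ℕ) : ℂ :=
  if i ≤ m then ((m.choose i : ℕ) : ℂ) * ((starRingEnd ℂ) (mat g 0 0)) ^ i * (-(mat g 0 1)) ^ (m - i)
  else 0

/-- The `n`-th Taylor coefficient of `(ā w - b)ᵐ K^{(k+m)}_{b/ā}(w)`: the Cauchy product. -/
noncomputable def kCoeff (k : ℕ) (g : SU11) (m n : ℕ) : ℂ :=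
  ∑ i ∈ range (n + 1), polyCoeff g m i * kernelCoeff (k + m) (orbit g) (n - i)

/-! ### The translate of a monomial -/

/-- `(ā w - b)ᵐ = Σ_{i ≤ m} p_i wⁱ`, as a `HasSum` over `ℕ`. -/
lemma hasSum_poly (g : SU11) (m : ℕ) (w : ℂ) :
    HasSum (fun i => polyCoeff g m i * w ^ i)
      (((starRingEnd ℂ) (mat g 0 0) * w + -(mat g 0 1)) ^ m) := by
  have h : ∀ i ∉ range (m + 1), polyCoeff g m i * w ^ i = 0 := by
    intro i hi
    rw [mem_range, not_lt] at hi
    simp [polyCoeff, show ¬ i ≤ m by omega]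
  have hs : HasSum (fun i => polyCoeff g m i * w ^ i) (∑ i ∈ range (m + 1), polyCoeff g m i * w ^ i) :=
    hasSum_sum_of_ne_finset_zero h
  convert hs using 1
  rw [add_pow]
  refine Finset.sum_congr rfl fun i hi => ?_
  rw [mem_range] at hi
  simp only [polyCoeff, if_pos (show i ≤ m by omega), mul_pow]
  ring

/-- **The translate of a monomial**: `(π_k(g) zᵐ)(w) = (ā w - b)ᵐ · (π_{k+m}(g) 1)(w)`. -/
lemma act_monomial_eq (k : ℕ) (g : SU11) (m : ℕ) (w : ℂ) :
    act k g (fun z => z ^ m) w =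
      ((starRingEnd ℂ) (mat g 0 0) * w + -(mat g 0 1)) ^ m * act (k + m) g lowest w := by
  rw [act_lowest_apply]
  unfold act
  simp only [mobius_inv_eq, div_pow]
  rw [pow_add, div_eq_mul_inv, ← inv_pow]
  ring

/-- `K^{(K)}_{z}` restricted to the norm point: the norm series of the coherent state is summable. -/
lemma summable_norm_kernelCoeff (K : ℕ) (hK : 2 ≤ K) {z w : ℂ} (hz : z ∈ ball (0 : ℂ) 1)
    (hw : w ∈ ball (0 : ℂ) 1) :
    Summable fun j => ‖kernelCoeff K z j * w ^ j‖ := by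
  have hz' : ((‖z‖ : ℝ) : ℂ) ∈ ball (0 : ℂ) 1 := by
    rw [mem_ball_zero_iff, Complex.norm_real, Real.norm_eq_abs, abs_norm]
    exact mem_ball_zero_iff.mp hz
  have hw' : ((‖w‖ : ℝ) : ℂ) ∈ ball (0 : ℂ) 1 := by
    rw [mem_ball_zero_iff, Complex.norm_real, Real.norm_eq_abs, abs_norm]
    exact mem_ball_zero_iff.mp hw
  have h := (hasSum_kernel K hK hz' hw').summable
  have e : (fun j => ‖kernelCoeff K z j * w ^ j‖) =
      fun j => (kernelCoeff K ((‖z‖ : ℝ) : ℂ) j * ((‖w‖ : ℝ) : ℂ) ^ j).re := by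
    funext j
    unfold kernelCoeff
    rw [norm_mul, norm_mul, norm_pow, norm_pow, Complex.norm_conj, Complex.norm_natCast,
      Complex.conj_ofReal, ← Complex.ofReal_pow, ← Complex.ofReal_pow, ← Complex.ofReal_natCast,
      ← Complex.ofReal_mul, ← Complex.ofReal_mul, Complex.ofReal_re]
  rw [e]
  have := Complex.reCLM.summable h
  simpa using this

/-- **The `K`-type expansion of `π_k(g) zᵐ`**: `(π_k(g) zᵐ)(w) = Σₙ a^{-(k+m)} c_n wⁿ` on the disc,
`c_n = Σ_{i ≤ n} p_i · kernelCoeff (k+m) (b/ā) (n-i)`. -/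
theorem act_monomial_hasSum (k : ℕ) (hk : 2 ≤ k) (g : SU11) (m : ℕ) {w : ℂ} (hw : w ∈ ball (0 : ℂ) 1) :
    HasSum (fun n => ((mat g 0 0)⁻¹ ^ (k + m) * kCoeff k g m n) * w ^ n)
      (act k g (fun z => z ^ m) w) := by
  have hK : 2 ≤ k + m := by omega
  rw [act_monomial_eq k g m w, act_lowest_eq_kernel (k + m) g w]
  have hP := hasSum_poly g m w
  have hKs := hasSum_kernel (k + m) hK (orbit_mem_ball g) hw
  have hPn : Summable fun i => ‖polyCoeff g m i * w ^ i‖ := by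
    refine summable_of_ne_finset_zero (s := range (m + 1)) fun i hi => ?_
    rw [mem_range, not_lt] at hi
    simp [polyCoeff, show ¬ i ≤ m by omega]
  have hKn := summable_norm_kernelCoeff (k + m) hK (orbit_mem_ball g) hw
  have hprod := hasSum_sum_range_mul_of_summable_norm hPn hKn
  rw [hP.tsum_eq, hKs.tsum_eq] at hprod
  have e : ∀ n, ∑ i ∈ range (n + 1), polyCoeff g m i * w ^ i *
      (kernelCoeff (k + m) (orbit g) (n - i) * w ^ (n - i)) = kCoeff k g m n * w ^ n := by
    intro n
    unfold kCoeff
    rw [Finset.sum_mul]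
    refine Finset.sum_congr rfl fun i hi => ?_
    rw [mem_range] at hi
    have : w ^ i * w ^ (n - i) = w ^ n := by
      rw [← pow_add]
      congr 1
      omega
    calc polyCoeff g m i * w ^ i * (kernelCoeff (k + m) (orbit g) (n - i) * w ^ (n - i))
        = polyCoeff g m i * kernelCoeff (k + m) (orbit g) (n - i) * (w ^ i * w ^ (n - i)) := by ring
      _ = polyCoeff g m i * kernelCoeff (k + m) (orbit g) (n - i) * w ^ n := by rw [this]
  simp_rw [e] at hprod
  have := hprod.mul_left ((mat g 0 0)⁻¹ ^ (k + m))
  have hfun : (fun n => (mat g 0 0)⁻¹ ^ (k + m) * kCoeff k g m n * w ^ n) =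
      fun n => (mat g 0 0)⁻¹ ^ (k + m) * (kCoeff k g m n * w ^ n) := by
    funext n
    ring
  have hsum : ((starRingEnd ℂ) (mat g 0 0) * w + -(mat g 0 1)) ^ m *
      ((mat g 0 0)⁻¹ ^ (k + m) * kernel (k + m) (orbit g) w) =
      (mat g 0 0)⁻¹ ^ (k + m) * (((starRingEnd ℂ) (mat g 0 0) * w + -(mat g 0 1)) ^ m *
        kernel (k + m) (orbit g) w) := by ring
  rw [hfun, hsum]
  exact this

/-! ### The closed form and the decay -/

/-- **The `K`-finite matrix coefficients in closed form**:
`⟨π_k(g) zᵐ, zⁿ⟩_k = a^{-(k+m)} · (Σ_{i ≤ n} p_i · C(n-i+k+m-1, n-i) (b̄/a)^{n-i}) · ⟨zⁿ, zⁿ⟩_k`. -/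
theorem matrixCoeff_monomial_monomial (k : ℕ) (hk : 2 ≤ k) (g : SU11) (m n : ℕ) :
    matrixCoeff k (fun z => z ^ m) (fun z => z ^ n) g =
      (mat g 0 0)⁻¹ ^ (k + m) * kCoeff k g m n * ((monomialNormSq k n : ℝ) : ℂ) := by
  unfold matrixCoeff
  exact pairing_monomial_right k hk _ (act k g (fun z => z ^ m))
    (fun w hw => act_monomial_hasSum k hk g m hw)
    (integrableOn_act k hk g _ (differentiableOn_monomial m) (integrableOn_monomial k m)) n

/-- `|p_i| ≤ C(m,i) |a|ᵐ` (as `|b| ≤ |a|`). -/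
lemma norm_polyCoeff_le (g : SU11) (m i : ℕ) :
    ‖polyCoeff g m i‖ ≤ ((m.choose i : ℕ) : ℝ) * ‖mat g 0 0‖ ^ m := by
  unfold polyCoeff
  split_ifs with h
  · rw [norm_mul, norm_mul, norm_pow, norm_pow, Complex.norm_conj, norm_neg, Complex.norm_natCast]
    have hb : ‖mat g 0 1‖ ≤ ‖mat g 0 0‖ := by
      have := norm_sq_sub_norm_sq g
      nlinarith [norm_nonneg (mat g 0 0), norm_nonneg (mat g 0 1)]
    have h1 : ‖mat g 0 1‖ ^ (m - i) ≤ ‖mat g 0 0‖ ^ (m - i) :=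
      pow_le_pow_left₀ (norm_nonneg _) hb _
    calc ((m.choose i : ℕ) : ℝ) * ‖mat g 0 0‖ ^ i * ‖mat g 0 1‖ ^ (m - i)
        ≤ ((m.choose i : ℕ) : ℝ) * ‖mat g 0 0‖ ^ i * ‖mat g 0 0‖ ^ (m - i) := by gcongr
      _ = ((m.choose i : ℕ) : ℝ) * ‖mat g 0 0‖ ^ m := by
          rw [mul_assoc, ← pow_add, Nat.add_sub_cancel' h]
  · simp only [norm_zero]
    positivity

/-- `|kernelCoeff K (orbit g) j| ≤ C(j+K-1, j)`. -/
lemma norm_kernelCoeff_orbit_le (K : ℕ) (g : SU11) (j : ℕ) :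
    ‖kernelCoeff K (orbit g) j‖ ≤ (((j + K - 1).choose j : ℕ) : ℝ) := by
  unfold kernelCoeff
  rw [norm_mul, norm_pow, Complex.norm_conj, Complex.norm_natCast]
  have h : ‖orbit g‖ ^ j ≤ 1 :=
    pow_le_one₀ (norm_nonneg _) (mem_ball_zero_iff.mp (orbit_mem_ball g)).le
  calc (((j + K - 1).choose j : ℕ) : ℝ) * ‖orbit g‖ ^ j
      ≤ (((j + K - 1).choose j : ℕ) : ℝ) * 1 := by gcongr
    _ = _ := mul_one _

/-- The combinatorial constant `C_{m,n} = Σ_{i ≤ n} C(m,i) C(n-i+k+m-1, n-i)`. -/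
noncomputable def decayConst (k m n : ℕ) : ℝ :=
  ∑ i ∈ range (n + 1), ((m.choose i : ℕ) : ℝ) * (((n - i + (k + m) - 1).choose (n - i) : ℕ) : ℝ)

/-- **Decay of the `K`-finite matrix coefficients**:
`|⟨π_k(g) zᵐ, zⁿ⟩_k| ≤ C_{m,n} ⟨zⁿ,zⁿ⟩_k · |a(g)|^{-k}`. -/
theorem norm_matrixCoeff_monomial_monomial_le (k : ℕ) (hk : 2 ≤ k) (g : SU11) (m n : ℕ) :
    ‖matrixCoeff k (fun z => z ^ m) (fun z => z ^ n) g‖ ≤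
      decayConst k m n * monomialNormSq k n * ‖mat g 0 0‖⁻¹ ^ k := by
  rw [matrixCoeff_monomial_monomial k hk g m n, norm_mul, norm_mul, norm_pow, norm_inv,
    Complex.norm_real, Real.norm_eq_abs, abs_of_pos (monomialNormSq_pos k n)]
  have ha : 0 < ‖mat g 0 0‖ := norm_pos_iff.mpr (mat_zero_zero_ne_zero g)
  have hc : ‖kCoeff k g m n‖ ≤ decayConst k m n * ‖mat g 0 0‖ ^ m := by
    unfold kCoeff decayConst
    rw [Finset.sum_mul]
    refine (norm_sum_le _ _).trans (Finset.sum_le_sum fun i _ => ?_)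
    rw [norm_mul]
    calc ‖polyCoeff g m i‖ * ‖kernelCoeff (k + m) (orbit g) (n - i)‖
        ≤ (((m.choose i : ℕ) : ℝ) * ‖mat g 0 0‖ ^ m) * (((n - i + (k + m) - 1).choose (n - i) : ℕ) : ℝ) :=
          mul_le_mul (norm_polyCoeff_le g m i) (norm_kernelCoeff_orbit_le (k + m) g (n - i))
            (norm_nonneg _) (by positivity)
      _ = _ := by ring
  have hm := (monomialNormSq_pos k n).le
  calc ‖mat g 0 0‖⁻¹ ^ (k + m) * ‖kCoeff k g m n‖ * monomialNormSq k n
      ≤ ‖mat g 0 0‖⁻¹ ^ (k + m) * (decayConst k m n * ‖mat g 0 0‖ ^ m) * monomialNormSq k n := by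
        gcongr
    _ = decayConst k m n * monomialNormSq k n * ‖mat g 0 0‖⁻¹ ^ k := by
        rw [pow_add]
        calc ‖mat g 0 0‖⁻¹ ^ k * ‖mat g 0 0‖⁻¹ ^ m * (decayConst k m n * ‖mat g 0 0‖ ^ m) *
              monomialNormSq k n
            = decayConst k m n * monomialNormSq k n * ‖mat g 0 0‖⁻¹ ^ k *
                (‖mat g 0 0‖⁻¹ ^ m * ‖mat g 0 0‖ ^ m) := by ring
          _ = _ := by rw [← mul_pow, inv_mul_cancel₀ ha.ne', one_pow, mul_one]

end Summit.Ventures.HodgeRepro2.T5BergmanKTypeMatrix
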